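import Summits.AtomisticToContinuum.FouriersLaw.Theorems.BondHeatUncertaintySubdiffusiveBondHeatSiteEnergyDynkinTruncation
import Summits.AtomisticToContinuum.FouriersLaw.Theorems.BondHeatUncertaintySubdiffusiveBondHeatBathBondReductionGenerator

/-!
# `SubdiffusiveBondHeat` / Dynkin's identity for the bath-site energy, part 2: the stub (H3)

Stub `stub_siteEnergyDynkin` (label (H3)) of line `bath-bond-deficit-integral` of crux `stmt-AtomisticToContinuum-9120`
(`BondHeatUncertainty.SubdiffusiveBondHeat`): for the pinned anharmonic chain `pinnedChain ω₂ lam β γ` (all parameters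
`> 0`), `N ≥ 2` sites, equal bath temperatures `T > 0`, the CONSTRUCTED transition kernels
`P_t = OscillatorChain.transitionKernel N T T t` (`LangevinChainKernel.lean`) and the bath-site energy
`e₀ = p₀²/2 + U(q₀) + ½V(q₁ - q₀)` (polynomially growing, not compactly supported),

  `P_r e₀(z) - e₀(z) = ∫₀ʳ P_s(L e₀)(z) ds`,   `L e₀ = γ(T - p₀²) - j₀`

(the pointwise generator identity is `pinnedChain_generator_siteEnergy`). Proof: the truncations `f_R = e₀ χ(H/R)`
(`χ = smoothCutoff`) are `C²_c`; by `generator_mul_smoothCutoff_hamiltonian` (part 1) their generator is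
`χ(H/R) Le₀ + err_R` with `|err_R| ≤ (A/R)(1 + H)²` (`pinnedChain_abs_generator_truncSiteEnergy_sub_le`:
`∂_{p₀}e₀ = p₀`, `∂_{p_{N-1}}e₀ = 0`, `χ', χ''` bounded, `e₀ ≤ 3H/2`, `p₀² + p²_{N-1} ≤ 4H`); with
`|Le₀| ≤ B(1 + H)²` and `(1 + H)² ≤ C e^{θH}` (`θ = 1/(2T)`) the truncation lemma `pinnedChain_dynkin_of_truncation`
of part 1 (dominated convergence through CEHR (3.4)) gives (H3).
-/

noncomputable section

open MeasureTheory ProbabilityTheory Filter Topology Set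
open scoped NNReal ENNReal

namespace Summit.AtomisticToContinuum.FouriersLaw.Theorems.SubdiffusiveBondHeat

open Literature.MathematicalPhysics.KineticTheory.HeatConduction
open Literature.MathematicalPhysics.KineticTheory Literature.Probability.Process OscillatorChain

variable {N : ℕ}

/-! ### The bath-site energy `e₀`: regularity, size, and the truncation error -/

section SiteEnergy

variable {ω₂ lam β γ : ℝ}

/-- The bath-site energy `e₀ = p_{i0}²/2 + U(q_{i0}) + ½V(q_{i1} - q_{i0})` is as smooth as the potentials. [folklore] -/
theorem contDiff_siteEnergy (P : OscillatorChain) {n : WithTop ℕ∞} (hU : ContDiff ℝ n P.U) (hV : ContDiff ℝ n P.V)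
    (i0 i1 : Fin N) :
    ContDiff ℝ n fun z : PhaseSpace N => (z.2 i0) ^ 2 / 2 + P.U (z.1 i0) + P.V (z.1 i1 - z.1 i0) / 2 := by
  have h1 : ContDiff ℝ n fun z : PhaseSpace N => z.2 i0 := (contDiff_apply ℝ ℝ i0).comp contDiff_snd
  have h2 : ContDiff ℝ n fun z : PhaseSpace N => z.1 i0 := (contDiff_apply ℝ ℝ i0).comp contDiff_fst
  have h3 : ContDiff ℝ n fun z : PhaseSpace N => z.1 i1 := (contDiff_apply ℝ ℝ i1).comp contDiff_fst
  exact (((h1.pow 2).div_const 2).add (hU.comp h2)).add ((hV.comp (h3.sub h2)).div_const 2)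

/-- `0 ≤ e₀ ≤ 3H/2` for the pinned chain (`ω₂, lam, β ≥ 0`, `N ≥ 2`): `p₀²/2 + U(q₀) ≤ H`, `V(q₁ - q₀) ≤ H`.
[folklore] -/
theorem pinnedChain_siteEnergy_nonneg_le (hω : 0 ≤ ω₂) (hl : 0 ≤ lam) (hβ : 0 ≤ β) (γ : ℝ) (hN : 1 < N)
    (y : PhaseSpace N) :
    0 ≤ (y.2 ⟨0, Nat.zero_lt_of_lt hN⟩) ^ 2 / 2 + (pinnedChain ω₂ lam β γ).U (y.1 ⟨0, Nat.zero_lt_of_lt hN⟩) +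
        (pinnedChain ω₂ lam β γ).V (y.1 ⟨1, hN⟩ - y.1 ⟨0, Nat.zero_lt_of_lt hN⟩) / 2 ∧
      (y.2 ⟨0, Nat.zero_lt_of_lt hN⟩) ^ 2 / 2 + (pinnedChain ω₂ lam β γ).U (y.1 ⟨0, Nat.zero_lt_of_lt hN⟩) +
        (pinnedChain ω₂ lam β γ).V (y.1 ⟨1, hN⟩ - y.1 ⟨0, Nat.zero_lt_of_lt hN⟩) / 2 ≤
      3 / 2 * (pinnedChain ω₂ lam β γ).hamiltonian N y := by
  have hU0 : ∀ q, 0 ≤ (pinnedChain ω₂ lam β γ).U q := fun q => by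
    show 0 ≤ ω₂ * q ^ 2 / 2 + lam * q ^ 4 / 4; positivity
  have hV0 : ∀ r, 0 ≤ (pinnedChain ω₂ lam β γ).V r := fun r => by
    show 0 ≤ r ^ 2 / 2 + β * r ^ 4 / 4; positivity
  have hsite := (pinnedChain ω₂ lam β γ).site_le_hamiltonian hU0 hV0 N y ⟨0, Nat.zero_lt_of_lt hN⟩
  have hbond := (pinnedChain ω₂ lam β γ).bond_le_hamiltonian hU0 hV0 N y
    (k := ⟨0, Nat.zero_lt_of_lt hN⟩) (l := ⟨1, hN⟩) rfl
  have hU1 := hU0 (y.1 ⟨0, Nat.zero_lt_of_lt hN⟩)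
  have hV1 := hV0 (y.1 ⟨1, hN⟩ - y.1 ⟨0, Nat.zero_lt_of_lt hN⟩)
  constructor
  · positivity
  · linarith

/-- **The truncation error for the bath-site energy.** For the pinned chain (`ω₂, lam, β, γ ≥ 0`, `N ≥ 2`, equal bath
temperatures `T ≥ 0`) there is `A ≥ 0` with
`|L(e₀ χ(H/R)) - χ(H/R) Le₀| ≤ (A/R) (1 + H)²` on phase space for all `R ≥ 1`: by
`generator_mul_smoothCutoff_hamiltonian` the difference is `e₀ Lχ_R + Γ(e₀, χ_R)`, where `∂_{p₀}e₀ = p₀`,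
`∂_{p_{N-1}}e₀ = 0`, `|χ'|, |χ''|` are bounded, `e₀ ≤ 3H/2`, `p₀² ≤ 2H`, `p₀² + p²_{N-1} ≤ 4H`. [folklore] -/
theorem pinnedChain_abs_generator_truncSiteEnergy_sub_le (hω : 0 ≤ ω₂) (hl : 0 ≤ lam) (hβ : 0 ≤ β) (hγ : 0 ≤ γ)
    (hN : 1 < N) {T : ℝ} (hT : 0 ≤ T) :
    ∃ A : ℝ, 0 ≤ A ∧ ∀ R : ℝ, 1 ≤ R → ∀ x : PhaseSpace N,
      |(pinnedChain ω₂ lam β γ).generator N T T (fun y =>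
            ((y.2 ⟨0, Nat.zero_lt_of_lt hN⟩) ^ 2 / 2 + (pinnedChain ω₂ lam β γ).U (y.1 ⟨0, Nat.zero_lt_of_lt hN⟩) +
              (pinnedChain ω₂ lam β γ).V (y.1 ⟨1, hN⟩ - y.1 ⟨0, Nat.zero_lt_of_lt hN⟩) / 2) *
            smoothCutoff ((pinnedChain ω₂ lam β γ).hamiltonian N y / R)) x -
          smoothCutoff ((pinnedChain ω₂ lam β γ).hamiltonian N x / R) *
            (pinnedChain ω₂ lam β γ).generator N T T (fun y =>
              (y.2 ⟨0, Nat.zero_lt_of_lt hN⟩) ^ 2 / 2 + (pinnedChain ω₂ lam β γ).U (y.1 ⟨0, Nat.zero_lt_of_lt hN⟩) +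
                (pinnedChain ω₂ lam β γ).V (y.1 ⟨1, hN⟩ - y.1 ⟨0, Nat.zero_lt_of_lt hN⟩) / 2) x| ≤
        A / R * (1 + (pinnedChain ω₂ lam β γ).hamiltonian N x) ^ 2 := by
  obtain ⟨M₁, hM₁0, hM₁⟩ := exists_bound_deriv_smoothCutoff
  obtain ⟨M₂, hM₂0, hM₂⟩ := exists_bound_deriv_deriv_smoothCutoff
  refine ⟨γ * (7 * M₁ * T + 6 * M₁ + 6 * M₂ * T), by positivity, fun R hR x => ?_⟩
  have hR0 : 0 < R := lt_of_lt_of_le one_pos hR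
  have hTγ : 0 ≤ (pinnedChain ω₂ lam β γ).γ * T := mul_nonneg hγ hT
  have hU2 : ContDiff ℝ 2 (pinnedChain ω₂ lam β γ).U := pinnedChain_contDiff_U ω₂ lam β γ
  have hV2 : ContDiff ℝ 2 (pinnedChain ω₂ lam β γ).V := pinnedChain_contDiff_V ω₂ lam β γ
  have he2 := contDiff_siteEnergy (pinnedChain ω₂ lam β γ) hU2 hV2 ⟨0, Nat.zero_lt_of_lt hN⟩ ⟨1, hN⟩
  have hne : (⟨N - 1, Nat.sub_lt (Nat.zero_lt_of_lt hN) one_pos⟩ : Fin N) ≠ ⟨0, Nat.zero_lt_of_lt hN⟩ := by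
    intro h
    have := congrArg Fin.val h
    simp only at this
    omega
  have hγ' : (pinnedChain ω₂ lam β γ).γ = γ := rfl
  rw [generator_mul_smoothCutoff_hamiltonian hU2 hV2 (Nat.zero_lt_of_lt hN) hTγ hTγ he2 R x,
    partialP_siteEnergy (pinnedChain ω₂ lam β γ), partialP_siteEnergy (pinnedChain ω₂ lam β γ), if_pos rfl,
    if_neg hne, hγ', add_sub_cancel_left]
  -- the elementary bounds
  obtain ⟨hE0, hEH⟩ := pinnedChain_siteEnergy_nonneg_le hω hl hβ γ hN x
  have hH0 : 0 ≤ (pinnedChain ω₂ lam β γ).hamiltonian N x := pinnedChain_hamiltonian_nonneg hω hl hβ γ N x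
  have hU0 : ∀ q, 0 ≤ (pinnedChain ω₂ lam β γ).U q := fun q => by
    show 0 ≤ ω₂ * q ^ 2 / 2 + lam * q ^ 4 / 4; positivity
  have hV0 : ∀ r, 0 ≤ (pinnedChain ω₂ lam β γ).V r := fun r => by
    show 0 ≤ r ^ 2 / 2 + β * r ^ 4 / 4; positivity
  have haH : x.2 ⟨0, Nat.zero_lt_of_lt hN⟩ ^ 2 ≤ 2 * (pinnedChain ω₂ lam β γ).hamiltonian N x := by
    have h1 := (pinnedChain ω₂ lam β γ).site_le_hamiltonian hU0 hV0 N x ⟨0, Nat.zero_lt_of_lt hN⟩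
    have h2 := hU0 (x.1 ⟨0, Nat.zero_lt_of_lt hN⟩)
    linarith
  have habH : x.2 ⟨0, Nat.zero_lt_of_lt hN⟩ ^ 2 + x.2 ⟨N - 1, Nat.sub_lt (Nat.zero_lt_of_lt hN) one_pos⟩ ^ 2 ≤
      4 * (pinnedChain ω₂ lam β γ).hamiltonian N x := by
    have := pinnedChain_sq_add_sq_le_hamiltonian hω hl hβ γ N x hne.symm
    linarith
  have hχ₁b := hM₁ ((pinnedChain ω₂ lam β γ).hamiltonian N x / R)
  have hχ₂b := hM₂ ((pinnedChain ω₂ lam β γ).hamiltonian N x / R)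
  -- make the atoms opaque
  generalize deriv smoothCutoff ((pinnedChain ω₂ lam β γ).hamiltonian N x / R) = χ₁ at hχ₁b ⊢
  generalize deriv (deriv smoothCutoff) ((pinnedChain ω₂ lam β γ).hamiltonian N x / R) = χ₂ at hχ₂b ⊢
  generalize (x.2 ⟨0, Nat.zero_lt_of_lt hN⟩) ^ 2 / 2 + (pinnedChain ω₂ lam β γ).U (x.1 ⟨0, Nat.zero_lt_of_lt hN⟩) +
    (pinnedChain ω₂ lam β γ).V (x.1 ⟨1, hN⟩ - x.1 ⟨0, Nat.zero_lt_of_lt hN⟩) / 2 = E at hE0 hEH ⊢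
  generalize (pinnedChain ω₂ lam β γ).hamiltonian N x = Hx at hH0 haH habH hEH ⊢
  generalize x.2 ⟨0, Nat.zero_lt_of_lt hN⟩ = p at haH habH ⊢
  generalize x.2 ⟨N - 1, Nat.sub_lt (Nat.zero_lt_of_lt hN) one_pos⟩ = q at habH ⊢
  -- real arithmetic: everything carries a factor `γ/R`
  have hb0 : 0 ≤ q ^ 2 := sq_nonneg _
  have ha0 : 0 ≤ p ^ 2 := sq_nonneg _
  have key : E * (γ * (χ₁ / R * (T + T - p ^ 2 - q ^ 2) + χ₂ / R ^ 2 * (T * p ^ 2 + T * q ^ 2))) +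
      χ₁ / R * (2 * γ * T * p * p + 2 * γ * T * q * 0) =
      γ / R * (E * (χ₁ * (2 * T - p ^ 2 - q ^ 2) + χ₂ * T * (p ^ 2 + q ^ 2) / R) + χ₁ * (2 * T * p ^ 2)) := by
    field_simp; ring
  have hin : |E * (χ₁ * (2 * T - p ^ 2 - q ^ 2) + χ₂ * T * (p ^ 2 + q ^ 2) / R) + χ₁ * (2 * T * p ^ 2)| ≤
      E * (M₁ * (2 * T + p ^ 2 + q ^ 2) + M₂ * T * (p ^ 2 + q ^ 2)) + M₁ * (2 * T * p ^ 2) := by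
    have h1 : |χ₁ * (2 * T - p ^ 2 - q ^ 2)| ≤ M₁ * (2 * T + p ^ 2 + q ^ 2) := by
      rw [abs_mul]
      refine mul_le_mul hχ₁b ?_ (abs_nonneg _) hM₁0
      rw [abs_le]; constructor <;> linarith
    have h2 : |χ₂ * T * (p ^ 2 + q ^ 2) / R| ≤ M₂ * T * (p ^ 2 + q ^ 2) := by
      rw [abs_div, abs_mul, abs_mul, abs_of_nonneg hT, abs_of_nonneg (add_nonneg ha0 hb0), abs_of_pos hR0]
      calc |χ₂| * T * (p ^ 2 + q ^ 2) / R ≤ |χ₂| * T * (p ^ 2 + q ^ 2) / 1 :=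
            div_le_div_of_nonneg_left (by positivity) one_pos hR
        _ ≤ M₂ * T * (p ^ 2 + q ^ 2) := by
            rw [div_one]
            exact mul_le_mul_of_nonneg_right (mul_le_mul_of_nonneg_right hχ₂b hT) (add_nonneg ha0 hb0)
    have h3 : |χ₁ * (2 * T * p ^ 2)| ≤ M₁ * (2 * T * p ^ 2) := by
      rw [abs_mul, abs_of_nonneg (by positivity : (0:ℝ) ≤ 2 * T * p ^ 2)]
      exact mul_le_mul_of_nonneg_right hχ₁b (by positivity)
    calc |E * (χ₁ * (2 * T - p ^ 2 - q ^ 2) + χ₂ * T * (p ^ 2 + q ^ 2) / R) + χ₁ * (2 * T * p ^ 2)|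
        ≤ |E * (χ₁ * (2 * T - p ^ 2 - q ^ 2) + χ₂ * T * (p ^ 2 + q ^ 2) / R)| + |χ₁ * (2 * T * p ^ 2)| :=
          abs_add_le _ _
      _ = E * |χ₁ * (2 * T - p ^ 2 - q ^ 2) + χ₂ * T * (p ^ 2 + q ^ 2) / R| + |χ₁ * (2 * T * p ^ 2)| := by
          rw [abs_mul, abs_of_nonneg hE0]
      _ ≤ E * (|χ₁ * (2 * T - p ^ 2 - q ^ 2)| + |χ₂ * T * (p ^ 2 + q ^ 2) / R|) + |χ₁ * (2 * T * p ^ 2)| := by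
          gcongr
          exact abs_add_le _ _
      _ ≤ E * (M₁ * (2 * T + p ^ 2 + q ^ 2) + M₂ * T * (p ^ 2 + q ^ 2)) + M₁ * (2 * T * p ^ 2) := by
          gcongr
  have hpoly : E * (M₁ * (2 * T + p ^ 2 + q ^ 2) + M₂ * T * (p ^ 2 + q ^ 2)) + M₁ * (2 * T * p ^ 2) ≤
      (7 * M₁ * T + 6 * M₁ + 6 * M₂ * T) * (1 + Hx) ^ 2 := by
    have s1 : E * (M₁ * (2 * T + p ^ 2 + q ^ 2) + M₂ * T * (p ^ 2 + q ^ 2)) ≤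
        (3 / 2 * Hx) * (M₁ * (2 * T + 4 * Hx) + M₂ * T * (4 * Hx)) := by
      refine mul_le_mul hEH ?_ (by positivity) (by positivity)
      have := mul_nonneg hM₂0 hT
      nlinarith
    have s2 : M₁ * (2 * T * p ^ 2) ≤ M₁ * (2 * T * (2 * Hx)) :=
      mul_le_mul_of_nonneg_left (mul_le_mul_of_nonneg_left haH (by positivity)) hM₁0
    nlinarith [mul_nonneg hM₁0 hT, mul_nonneg (mul_nonneg hM₁0 hT) hH0, mul_nonneg hM₁0 hH0,
      mul_nonneg (mul_nonneg hM₁0 hT) (sq_nonneg Hx), mul_nonneg hM₂0 hT,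
      mul_nonneg (mul_nonneg hM₂0 hT) hH0]
  rw [key, abs_mul, abs_div, abs_of_nonneg hγ, abs_of_pos hR0]
  calc γ / R * |E * (χ₁ * (2 * T - p ^ 2 - q ^ 2) + χ₂ * T * (p ^ 2 + q ^ 2) / R) + χ₁ * (2 * T * p ^ 2)|
      ≤ γ / R * (E * (M₁ * (2 * T + p ^ 2 + q ^ 2) + M₂ * T * (p ^ 2 + q ^ 2)) + M₁ * (2 * T * p ^ 2)) :=
        mul_le_mul_of_nonneg_left hin (div_nonneg hγ hR0.le)
    _ ≤ γ / R * ((7 * M₁ * T + 6 * M₁ + 6 * M₂ * T) * (1 + Hx) ^ 2) :=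
        mul_le_mul_of_nonneg_left hpoly (div_nonneg hγ hR0.le)
    _ = γ * (7 * M₁ * T + 6 * M₁ + 6 * M₂ * T) / R * (1 + Hx) ^ 2 := by ring

end SiteEnergy

/-! ### (H3): Dynkin's identity for the bath-site energy -/

section Main

/-- **(H3) Dynkin's identity for the bath-site energy of the pinned anharmonic chain.** For
`pinnedChain ω₂ lam β γ` (`ω₂, lam, β, γ > 0`), `N ≥ 2`, equal bath temperatures `T > 0`, the constructed transition
kernels `P_t = OscillatorChain.transitionKernel N T T t` and `e₀ = p₀²/2 + U(q₀) + ½V(q₁ - q₀)`: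
`P_r e₀(z) - e₀(z) = ∫₀ʳ P_s(γ(T - p₀²) - j₀)(z) ds` for all `r ≥ 0` and `z` — Dynkin's formula
`E_z f(z_t) - f(z) = E_z ∫₀ᵗ Lf(z_s) ds` for the polynomially bounded observable `f = e₀`, `Le₀ = γ(T - p₀²) - j₀`
(`pinnedChain_generator_siteEnergy`), obtained from the `C²_c` case by the truncations `e₀ χ(H/R)`
(`pinnedChain_dynkin_of_truncation`, `pinnedChain_abs_generator_truncSiteEnergy_sub_le`), all error terms being
`O((1 + H)²/R) = O(e^{H/(2T)}/R)` and the kernels integrating `e^{H/(2T)}` (CEHR (3.4)).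
[cite: CuneoEckmannHairerReyBellet2018, §3 eq. (3.2)–(3.4)] -/
theorem stub_siteEnergyDynkin :
    ∀ ω₂ lam β γ : ℝ, 0 < ω₂ → 0 < lam → 0 < β → 0 < γ → ∀ T : ℝ, 0 < T → ∀ (N : ℕ) (hN : 1 < N),
      ∀ (r : NNReal) (z : PhaseSpace N),
        ∫ y, ((y.2 ⟨0, Nat.zero_lt_of_lt hN⟩) ^ 2 / 2 + (pinnedChain ω₂ lam β γ).U (y.1 ⟨0, Nat.zero_lt_of_lt hN⟩) +
              (pinnedChain ω₂ lam β γ).V (y.1 ⟨1, hN⟩ - y.1 ⟨0, Nat.zero_lt_of_lt hN⟩) / 2)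
            ∂((pinnedChain ω₂ lam β γ).transitionKernel N T T r z) -
          ((z.2 ⟨0, Nat.zero_lt_of_lt hN⟩) ^ 2 / 2 + (pinnedChain ω₂ lam β γ).U (z.1 ⟨0, Nat.zero_lt_of_lt hN⟩) +
            (pinnedChain ω₂ lam β γ).V (z.1 ⟨1, hN⟩ - z.1 ⟨0, Nat.zero_lt_of_lt hN⟩) / 2) =
        ∫ s in (0 : ℝ)..(r : ℝ), ∫ y, (γ * (T - (y.2 ⟨0, Nat.zero_lt_of_lt hN⟩) ^ 2) -
            (pinnedChain ω₂ lam β γ).bondCurrent N ⟨0, Nat.zero_lt_of_lt hN⟩ y)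
          ∂((pinnedChain ω₂ lam β γ).transitionKernel N T T s.toNNReal z) := by
  intro ω₂ lam β γ hω hl hβ hγ T hT N hN r z
  have hN0 : 0 < N := Nat.zero_lt_of_lt hN
  -- the constants
  obtain ⟨A, hA0, hA⟩ := pinnedChain_abs_generator_truncSiteEnergy_sub_le hω.le hl.le hβ.le hγ.le hN hT.le
  set θ : ℝ := 1 / (2 * T) with hθ
  have hθ0 : 0 < θ := by positivity
  have hθ1 : θ < 1 / T := by
    rw [hθ, div_lt_div_iff₀ (by positivity) hT]; nlinarith
  set B : ℝ := γ * (T + 1) + N * ((3 + β) / 2) with hB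
  have hB0 : 0 ≤ B := by positivity
  set C₀ : ℝ := 2 * Real.exp θ / θ ^ 2 with hC₀
  have hC₀0 : 0 ≤ C₀ := by positivity
  -- the observable, its generator image, the truncations
  set e : PhaseSpace N → ℝ := fun y => (y.2 ⟨0, Nat.zero_lt_of_lt hN⟩) ^ 2 / 2 +
    (pinnedChain ω₂ lam β γ).U (y.1 ⟨0, Nat.zero_lt_of_lt hN⟩) +
    (pinnedChain ω₂ lam β γ).V (y.1 ⟨1, hN⟩ - y.1 ⟨0, Nat.zero_lt_of_lt hN⟩) / 2 with he
  set ℓ : PhaseSpace N → ℝ := fun y => γ * (T - (y.2 ⟨0, Nat.zero_lt_of_lt hN⟩) ^ 2) -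
    (pinnedChain ω₂ lam β γ).bondCurrent N ⟨0, Nat.zero_lt_of_lt hN⟩ y with hℓ
  set f : ℕ → PhaseSpace N → ℝ := fun n y =>
    e y * smoothCutoff ((pinnedChain ω₂ lam β γ).hamiltonian N y / (n + 1)) with hf
  have hfdef : ∀ n y, f n y = e y * smoothCutoff ((pinnedChain ω₂ lam β γ).hamiltonian N y / (n + 1)) :=
    fun n y => rfl
  -- regularity and compact support
  have hU2 : ContDiff ℝ 2 (pinnedChain ω₂ lam β γ).U := pinnedChain_contDiff_U ω₂ lam β γ
  have hV2 : ContDiff ℝ 2 (pinnedChain ω₂ lam β γ).V := pinnedChain_contDiff_V ω₂ lam β γ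
  have he2 : ContDiff ℝ 2 e := contDiff_siteEnergy (pinnedChain ω₂ lam β γ) hU2 hV2 _ _
  have hH2 : ContDiff ℝ 2 ((pinnedChain ω₂ lam β γ).hamiltonian N) :=
    (pinnedChain ω₂ lam β γ).contDiff_hamiltonian hU2 hV2 N
  have hH0 : ∀ y, 0 ≤ (pinnedChain ω₂ lam β γ).hamiltonian N y := fun y =>
    pinnedChain_hamiltonian_nonneg hω.le hl.le hβ.le γ N y
  have hRpos : ∀ n : ℕ, (0:ℝ) < n + 1 := fun n => by positivity
  have hR1 : ∀ n : ℕ, (1:ℝ) ≤ n + 1 := fun n => by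
    have : (0:ℝ) ≤ n := Nat.cast_nonneg n
    linarith
  have hf2 : ∀ n, ContDiff ℝ 2 (f n) := fun n =>
    he2.mul ((contDiff_smoothCutoff (n := 2)).comp (hH2.div_const _))
  have hfs : ∀ n, HasCompactSupport (f n) := fun n => by
    refine HasCompactSupport.intro
      (pinnedChain_isCompact_setOf_hamiltonian_le hω hl.le hβ.le γ N (2 * (n + 1))) fun y hy => ?_
    simp only [mem_setOf_eq, not_le] at hy
    have h2 : 2 ≤ (pinnedChain ω₂ lam β γ).hamiltonian N y / (n + 1) := by
      rw [le_div_iff₀ (hRpos n)]; linarith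
    rw [hfdef, smoothCutoff_of_two_le h2, mul_zero]
  -- the generator image of `e` is `ℓ`
  have hgen : ∀ x, (pinnedChain ω₂ lam β γ).generator N T T e x = ℓ x := fun x => by
    have h := pinnedChain_generator_siteEnergy ω₂ lam β γ T T N hN x
    rw [he, hℓ, h]
    ring
  -- eventually the cutoff is `1`
  have hev : ∀ y, ∀ᶠ n : ℕ in atTop, smoothCutoff ((pinnedChain ω₂ lam β γ).hamiltonian N y / (n + 1)) = 1 := by
    intro y
    obtain ⟨n₀, hn₀⟩ := exists_nat_ge ((pinnedChain ω₂ lam β γ).hamiltonian N y)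
    filter_upwards [eventually_ge_atTop n₀] with n hn
    have h1 : (pinnedChain ω₂ lam β γ).hamiltonian N y / (n + 1) ≤ 1 := by
      rw [div_le_one (hRpos n)]
      have : (n₀ : ℝ) ≤ n := by exact_mod_cast hn
      linarith
    exact smoothCutoff_of_le_one h1
  -- size estimates
  have hsq : ∀ y, (1 + (pinnedChain ω₂ lam β γ).hamiltonian N y) ^ 2 ≤
      C₀ * Real.exp (θ * (pinnedChain ω₂ lam β γ).hamiltonian N y) := fun y => one_add_sq_le_exp (hH0 y) hθ0
  have hebd : ∀ y, 0 ≤ e y ∧ e y ≤ 3 / 2 * (pinnedChain ω₂ lam β γ).hamiltonian N y := fun y =>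
    pinnedChain_siteEnergy_nonneg_le hω.le hl.le hβ.le γ hN y
  have hℓb : ∀ y, |ℓ y| ≤ B * (1 + (pinnedChain ω₂ lam β γ).hamiltonian N y) ^ 2 := fun y => by
    have hj := pinnedChain_abs_bondCurrent_le hω.le hl.le hβ.le γ N ⟨0, Nat.zero_lt_of_lt hN⟩ y
    have hU0 : 0 ≤ (pinnedChain ω₂ lam β γ).U (y.1 ⟨0, Nat.zero_lt_of_lt hN⟩) := by
      show 0 ≤ ω₂ * (y.1 ⟨0, Nat.zero_lt_of_lt hN⟩) ^ 2 / 2 + lam * (y.1 ⟨0, Nat.zero_lt_of_lt hN⟩) ^ 4 / 4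
      positivity
    have hp : (y.2 ⟨0, Nat.zero_lt_of_lt hN⟩) ^ 2 ≤ 2 * (pinnedChain ω₂ lam β γ).hamiltonian N y := by
      have := (hebd y).2
      have hV0 : 0 ≤ (pinnedChain ω₂ lam β γ).V (y.1 ⟨1, hN⟩ - y.1 ⟨0, Nat.zero_lt_of_lt hN⟩) := by
        show 0 ≤ (y.1 ⟨1, hN⟩ - y.1 ⟨0, Nat.zero_lt_of_lt hN⟩) ^ 2 / 2 +
          β * (y.1 ⟨1, hN⟩ - y.1 ⟨0, Nat.zero_lt_of_lt hN⟩) ^ 4 / 4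
        positivity
      have hs := (pinnedChain ω₂ lam β γ).site_le_hamiltonian (fun q => by
          show 0 ≤ ω₂ * q ^ 2 / 2 + lam * q ^ 4 / 4; positivity) (fun r => by
          show 0 ≤ r ^ 2 / 2 + β * r ^ 4 / 4; positivity) N y ⟨0, Nat.zero_lt_of_lt hN⟩
      linarith
    have hHy := hH0 y
    rw [hℓ]
    dsimp only
    generalize (pinnedChain ω₂ lam β γ).hamiltonian N y = Hy at hj hp hHy ⊢
    generalize (pinnedChain ω₂ lam β γ).bondCurrent N ⟨0, Nat.zero_lt_of_lt hN⟩ y = j at hj ⊢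
    generalize y.2 ⟨0, Nat.zero_lt_of_lt hN⟩ = p at hp ⊢
    have h1 : |γ * (T - p ^ 2)| ≤ γ * (T + 1) * (1 + Hy) ^ 2 := by
      rw [abs_mul, abs_of_pos hγ, mul_assoc]
      refine mul_le_mul_of_nonneg_left ?_ hγ.le
      have : |T - p ^ 2| ≤ T + p ^ 2 := by
        rw [abs_le]; constructor <;> nlinarith [sq_nonneg p]
      nlinarith [mul_nonneg hT.le hHy, mul_nonneg hT.le (sq_nonneg Hy), sq_nonneg Hy]
    calc |γ * (T - p ^ 2) - j| ≤ |γ * (T - p ^ 2)| + |j| := abs_sub _ _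
      _ ≤ γ * (T + 1) * (1 + Hy) ^ 2 + N * ((3 + β) / 2 * (1 + Hy) ^ 2) := add_le_add h1 hj
      _ = (γ * (T + 1) + N * ((3 + β) / 2)) * (1 + Hy) ^ 2 := by ring
  -- the truncation error, with `Le = ℓ`
  have herr : ∀ (n : ℕ) (y : PhaseSpace N),
      |(pinnedChain ω₂ lam β γ).generator N T T (f n) y -
          smoothCutoff ((pinnedChain ω₂ lam β γ).hamiltonian N y / (n + 1)) * ℓ y| ≤
        A / (n + 1) * (1 + (pinnedChain ω₂ lam β γ).hamiltonian N y) ^ 2 := by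
    intro n y
    have h : |(pinnedChain ω₂ lam β γ).generator N T T (f n) y -
        smoothCutoff ((pinnedChain ω₂ lam β γ).hamiltonian N y / (n + 1)) *
          (pinnedChain ω₂ lam β γ).generator N T T e y| ≤
        A / (n + 1) * (1 + (pinnedChain ω₂ lam β γ).hamiltonian N y) ^ 2 := hA (n + 1) (hR1 n) y
    rw [hgen y] at h
    exact h
  -- the uniform exponential domination of `f_n` and `L f_n`
  have hfb : ∀ (n : ℕ) (y : PhaseSpace N),
      |f n y| ≤ (A + B + 3 / 2) * C₀ * Real.exp (θ * (pinnedChain ω₂ lam β γ).hamiltonian N y) := by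
    intro n y
    obtain ⟨h0, h1⟩ := hebd y
    have hχ0 := smoothCutoff_nonneg ((pinnedChain ω₂ lam β γ).hamiltonian N y / (n + 1))
    have hχ1 := smoothCutoff_le_one ((pinnedChain ω₂ lam β γ).hamiltonian N y / (n + 1))
    have hs := hsq y
    have hHy := hH0 y
    rw [hfdef, abs_of_nonneg (mul_nonneg h0 hχ0)]
    generalize (pinnedChain ω₂ lam β γ).hamiltonian N y = Hy at h1 hs hHy hχ0 hχ1 ⊢
    generalize smoothCutoff (Hy / (n + 1)) = c at hχ0 hχ1 ⊢
    generalize e y = E at h0 h1 ⊢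
    calc E * c ≤ E := mul_le_of_le_one_right h0 hχ1
      _ ≤ 3 / 2 * (1 + Hy) ^ 2 := by nlinarith
      _ ≤ (A + B + 3 / 2) * (1 + Hy) ^ 2 := by gcongr; linarith
      _ ≤ (A + B + 3 / 2) * (C₀ * Real.exp (θ * Hy)) := by gcongr
      _ = (A + B + 3 / 2) * C₀ * Real.exp (θ * Hy) := by ring
  have hLb : ∀ (n : ℕ) (y : PhaseSpace N), |(pinnedChain ω₂ lam β γ).generator N T T (f n) y| ≤
      (A + B + 3 / 2) * C₀ * Real.exp (θ * (pinnedChain ω₂ lam β γ).hamiltonian N y) := by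
    intro n y
    have h1 := herr n y
    have h2 := hℓb y
    have hs := hsq y
    have hHy := hH0 y
    have hχ0 := smoothCutoff_nonneg ((pinnedChain ω₂ lam β γ).hamiltonian N y / (n + 1))
    have hχ1 := smoothCutoff_le_one ((pinnedChain ω₂ lam β γ).hamiltonian N y / (n + 1))
    generalize (pinnedChain ω₂ lam β γ).generator N T T (f n) y = G at h1 ⊢
    generalize (pinnedChain ω₂ lam β γ).hamiltonian N y = Hy at h1 h2 hs hHy hχ0 hχ1 ⊢
    generalize smoothCutoff (Hy / (n + 1)) = c at hχ0 hχ1 h1 ⊢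
    generalize ℓ y = l at h1 h2 ⊢
    have h3 : |c * l| ≤ B * (1 + Hy) ^ 2 := by
      rw [abs_mul, abs_of_nonneg hχ0]
      calc c * |l| ≤ 1 * |l| := mul_le_mul_of_nonneg_right hχ1 (abs_nonneg _)
        _ ≤ B * (1 + Hy) ^ 2 := by rw [one_mul]; exact h2
    have h4 : A / (n + 1) * (1 + Hy) ^ 2 ≤ A * (1 + Hy) ^ 2 :=
      mul_le_mul_of_nonneg_right (div_le_self hA0 (hR1 n)) (sq_nonneg _)
    calc |G| ≤ |G - c * l| + |c * l| := by
          have := abs_add_le (G - c * l) (c * l); rwa [sub_add_cancel] at this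
      _ ≤ A * (1 + Hy) ^ 2 + B * (1 + Hy) ^ 2 := add_le_add (h1.trans h4) h3
      _ ≤ (A + B + 3 / 2) * (1 + Hy) ^ 2 := by nlinarith [sq_nonneg (1 + Hy)]
      _ ≤ (A + B + 3 / 2) * (C₀ * Real.exp (θ * Hy)) := by gcongr
      _ = (A + B + 3 / 2) * C₀ * Real.exp (θ * Hy) := by ring
  -- pointwise convergence of `f_n` and `L f_n`
  have hfe : ∀ y, Tendsto (fun n => f n y) atTop (𝓝 (e y)) := fun y => by
    refine tendsto_const_nhds.congr' ?_
    filter_upwards [hev y] with n hn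
    rw [hfdef, hn, mul_one]
  have hfℓ : ∀ y, Tendsto (fun n => (pinnedChain ω₂ lam β γ).generator N T T (f n) y) atTop (𝓝 (ℓ y)) := by
    intro y
    have hg : Tendsto (fun n : ℕ => smoothCutoff ((pinnedChain ω₂ lam β γ).hamiltonian N y / (n + 1)) * ℓ y)
        atTop (𝓝 (ℓ y)) := by
      refine tendsto_const_nhds.congr' ?_
      filter_upwards [hev y] with n hn
      rw [hn, one_mul]
    have hd : Tendsto (fun n : ℕ => (pinnedChain ω₂ lam β γ).generator N T T (f n) y -
        smoothCutoff ((pinnedChain ω₂ lam β γ).hamiltonian N y / (n + 1)) * ℓ y) atTop (𝓝 0) := by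
      have hCn : Tendsto (fun n : ℕ => A / (n + 1) * (1 + (pinnedChain ω₂ lam β γ).hamiltonian N y) ^ 2)
          atTop (𝓝 0) := by
        have h1 : Tendsto (fun n : ℕ => A / ((n : ℝ) + 1)) atTop (𝓝 0) :=
          tendsto_const_nhds.div_atTop (tendsto_natCast_atTop_atTop.atTop_add tendsto_const_nhds)
        simpa using h1.mul_const ((1 + (pinnedChain ω₂ lam β γ).hamiltonian N y) ^ 2)
      exact squeeze_zero_norm (fun n => by rw [Real.norm_eq_abs]; exact herr n y) hCn
    have := hd.add hg
    simpa using this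
  exact pinnedChain_dynkin_of_truncation hω hl.le hβ hγ hN0 hT hθ0 hθ1 f hf2 hfs hfe hfℓ hfb hLb r z

end Main

end Summit.AtomisticToContinuum.FouriersLaw.Theorems.SubdiffusiveBondHeat

end
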